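import Mathlib
import Summits.ValiantsHypothesis.ValiantsHypothesis.Theorems.PermanentalConesPermanentalConeHardSlackAsPermanent

/-!
# `PermanentalConeHard` (stmt-ValiantsHypothesis-8654) — column scaling of permanental polynomials
(infrastructure for the no-go `stub_twoRowsNotWitness`, lead c3).

For the permanental family `P_Y = per[(Y)_{rows<r}; x^{(N-r)}]` and a nowhere-zero scaling vector
`b`, evaluating `P_Y` at `b ∘ y` gives `(∏ⱼ bⱼ) · P_{Y∘b⁻¹}(y)`, where `(Y∘b⁻¹) i j = Y i j * (b j)⁻¹`:
both sides are real permanents (`eval_rowPermanent`), the real matrix `[(Y)_{<r}; (b∘y)^{(N-r)}]`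
is `[(Y∘b⁻¹)_{<r}; y^{(N-r)}]` with every column `j` multiplied by `b j`, and
`per (M · diag b) = (∏ b) · per M` (`permanent_colScale`).  Everything here is elementary.
-/

set_option linter.dupNamespace false

noncomputable section

namespace Summit.ValiantsHypothesis.ValiantsHypothesis.Theorems.PermanentalConesPermanentalConeHard

open MvPolynomial Finset
open scoped BigOperators Matrix

/-- Column scaling of the permanent: multiplying every column `j` of `M` by `b j` multiplies the
permanent by `∏ⱼ b j`, i.e. `per (M · diag b) = (∏ b) · per M`. [folklore] -/
theorem permanent_colScale {m : Type*} [DecidableEq m] [Fintype m] {R : Type*} [CommSemiring R]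
    (M : Matrix m m R) (b : m → R) :
    (Matrix.of fun i j => M i j * b j).permanent = (∏ j, b j) * M.permanent := by
  unfold Matrix.permanent
  rw [Finset.mul_sum]
  refine Finset.sum_congr rfl fun σ _ => ?_
  simp only [Matrix.of_apply]
  rw [Finset.prod_mul_distrib]
  exact mul_comm _ _

/-- **Column scaling of permanental polynomials** (registered stub `stub_rowPermanent_colScale`):
for `b` nowhere zero, `P_Y(b ∘ y) = (∏ⱼ bⱼ) · P_{Y∘b⁻¹}(y)`, where
`P_Y = per[(Y)_{rows<r}; x^{(N-r)}]` and `(Y∘b⁻¹) i j = Y i j * (b j)⁻¹`. [folklore] -/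
theorem stub_rowPermanent_colScale : ∀ (N r : ℕ) (Y : Matrix (Fin N) (Fin N) ℝ) (b y : Fin N → ℝ), (∀ j, b j ≠ 0) → MvPolynomial.eval (fun j => b j * y j) (Matrix.of fun i j : Fin N => if (i : ℕ) < r then MvPolynomial.C (Y i j) else MvPolynomial.X j).permanent = (∏ j, b j) * MvPolynomial.eval y (Matrix.of fun i j : Fin N => if (i : ℕ) < r then MvPolynomial.C (Y i j * (b j)⁻¹) else MvPolynomial.X j).permanent := by
  intro N r Y b y hb
  rw [eval_rowPermanent Y r (fun j => b j * y j),
    eval_rowPermanent (fun i j => Y i j * (b j)⁻¹) r y, ← permanent_colScale]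
  congr 1
  ext i j
  simp only [Matrix.of_apply]
  split_ifs
  · rw [inv_mul_cancel_right₀ (hb j)]
  · exact mul_comm _ _

end Summit.ValiantsHypothesis.ValiantsHypothesis.Theorems.PermanentalConesPermanentalConeHard

end
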